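import Summits.HodgeConjecture.HodgeConjecture.Theorems.FiniteTreeOfFlavoursMovableClassesAlgebraicSpecialisation
import Summits.HodgeConjecture.HodgeConjecture.Statement
import HarnessLib

/-!
# Crux `KClassPropagates` (stmt-HodgeConjecture-9314) — stub S3 `stub_spreadAlongCurve`: its registered form implies the SUMMIT; the dominant form is a theorem

Route `TateCuspKLift`, crux #3 `Theses.TateCuspKLift.KClassPropagates`, registered skeleton
`Cruxes/KClassPropagates/Lines/birth.lean`, stub S3 `stub_spreadAlongCurve : SpreadAlongCurve` ("spreading
along the curve"; countably many relative Chow components, one dominates): for `f : 𝒳 ⟶ C` with `𝒳` a smooth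
projective `N`-fold and `C` a smooth projective curve, a rational `(p,p)` class `ξ ∈ H²ᵖ(𝒳(ℂ); ℂ)`, and a
non-empty Zariski-open `U ⊆ C`: if `ξ|_{𝒳_t}` is algebraic on every SMOOTH PROJECTIVE fibre over `U`, then it is
algebraic on every smooth projective fibre of `f`.

Two kernel facts about this statement (its body is restated verbatim, the crux file being a workfile):

* `hodgeConjecture_of_spreadAlongCurve` — **AS REGISTERED, S3 IMPLIES THE SUMMIT
  `HodgeConjecture` (`Summits/HodgeConjecture/HodgeConjecture/Statement.lean`).** Nothing in the statement forces `f` to be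
  dominant or the fibre dimension `n` to be `N - 1`: for ANY smooth projective `X` take `C = ℙ¹`, the
  CONSTANT map `f = (X → Spec ℂ) ≫ t₀` at a complex point `t₀`, and `U = C ∖ {pt t₀}` (non-empty open: `ℙ¹(ℂ)`
  is uncountable). The fibres over `U` are EMPTY, so the hypothesis is vacuous; the fibre over `t₀` is `X`
  itself (`𝒳_{t₀} ⟶ X` is the base change of the monomorphism `t₀ : Spec ℂ ⟶ ℙ¹` along `(X → Spec ℂ) ≫ t₀`, an
  isomorphism), smooth projective of dimension `n = N`; the conclusion is the Hodge conjecture for `(X, p)`.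
  (The registrar's BC3 probes `stub → HodgeConjecture` by `exact? / simpa / aesop` could not see this: it needs
  the constant-family construction.)
* `spreadAlongCurve_of_dim_succ` — **THE DOMINANT CASE IS A THEOREM**: the same statement with the target
  fibre of dimension `n = N - 1` (stated as `𝒳` of dimension `n + 1`), proved like stub 3 of the sister crux
  `MovableClassesAlgebraic` (`Theorems.stub_specialisation`, p250529): `f` is then dominant
  (`Theorems.isDominant_of_isSmoothProjective_fiberOver`), flat over the curve, smooth of relative dimension
  `n` with smooth projective fibres over an affine open `V ∋ pt t` (fibre criterion + Ehresmann irreducibility),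
  and the DISCHARGED structure theorem on algebraicity loci in its curve-base form
  (`HodgeTheory.mem_algebraicClasses_of_not_countable_of_smoothCurve`) spreads algebraicity from the uncountably
  many good fibres over `V ∩ U` to `t`.

Suggested REPAIR of S3 for the lead / planner (stub-misstated, not false): pin the fibre dimension
(`IsSmoothProjective (n + 1) 𝒳` with fibres `IsSmoothProjective n`) or add the dominance clause
`Function.Surjective f.left.base` of the route-repair package of 2026-08-15 (items 9312–9315) to S3 as well;
the composition `KClassPropagates_of` only uses S3 at fibres of the correct dimension.
No definition, no named fact, no `sorry`.

References: [CharlesSchnell2014Notes] F. Charles, C. Schnell, Notes on absolute Hodge classes (2014),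
Prop. 11.3.11; [VoisinHodgeII2003] C. Voisin, Hodge Theory and Complex Algebraic Geometry II (2003), §3.3.1;
[Deligne2000] P. Deligne, The Hodge conjecture (Clay, 2000), §1.
-/

-- `Summit.<Summit>.<Problem>`: for the single-conjunct summit `HodgeConjecture` the duplicate component is mandated.
set_option linter.dupNamespace false

noncomputable section

open CategoryTheory CategoryTheory.Limits AlgebraicGeometry TopologicalSpace
open Literature.AlgebraicGeometry Literature.AlgebraicGeometry.Motives Literature.AlgebraicGeometry.HodgeTheory

namespace Summit.HodgeConjecture.HodgeConjecture.Theorems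

section ConstantMap

variable {X C : SchemeOver ℂ} (t₀ : ComplexPoints C)

/-- The constant map `X → Spec ℂ → C` at `t₀` sends every point to `pt t₀`. [folklore] -/
theorem toSpecOver_comp_left_apply (w : X.left) : (toSpecOver X ≫ t₀).left w = t₀.pt := by
  rw [Over.comp_left, Scheme.Hom.comp_apply]
  haveI : Subsingleton ((specOver ℂ ℂ).left : Type) := inferInstanceAs (Subsingleton (PrimeSpectrum ℂ))
  rw [Subsingleton.elim ((toSpecOver X).left w) (IsLocalRing.closedPoint ℂ)]
  rfl

/-- A point of the fibre of `f : 𝒴 ⟶ C` over `t` maps to `pt t` under `f`. [folklore] -/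
theorem left_fiberι_apply {𝒴 : SchemeOver ℂ} (f : 𝒴 ⟶ C) (t : ComplexPoints C) (z : (fiberOver f t).left) :
    f.left ((fiberι f t).left z) = t.pt := by
  have hcomp := congrArg (fun g ↦ g.left.base z) (fiberι_comp f t)
  simp only [Over.comp_left, Scheme.Hom.comp_base, TopCat.coe_comp, Function.comp_apply] at hcomp
  rw [hcomp]
  haveI : Subsingleton ((specOver ℂ ℂ).left : Type) := inferInstanceAs (Subsingleton (PrimeSpectrum ℂ))
  rw [Subsingleton.elim ((fiberOverToSpec f t).left.base z) (IsLocalRing.closedPoint ℂ)]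
  rfl

/-- **The fibre of the constant map at `t₀` over `t₀` is `X`**: `𝒳_{t₀} ⟶ X` is the base change of the
monomorphism `t₀ : Spec ℂ ⟶ C` along `(X → Spec ℂ) ≫ t₀`, hence an isomorphism (Mathlib
`pullback_snd_iso_of_left_factors_mono`). [folklore] -/
theorem isIso_fiberι_toSpecOver_comp [LocallyOfFiniteType C.hom] : IsIso (fiberι (toSpecOver X ≫ t₀) t₀).left := by
  haveI : IsClosedImmersion t₀.left := AlgPoints.isClosedImmersion_toSpecHom C t₀
  change IsIso (pullback.fst ((toSpecOver X).left ≫ t₀.left) t₀.left)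
  infer_instance

/-- The fibre of the constant map at `t₀` over a complex point `t ≠ t₀` is empty. [folklore] -/
theorem isEmpty_fiberOver_toSpecOver_comp [LocallyOfFiniteType C.hom] {t : ComplexPoints C} (ht : t ≠ t₀) :
    IsEmpty (fiberOver (toSpecOver X ≫ t₀) t).left := by
  refine ⟨fun z => ht (Motives.ComplexPoints.ext_of_pt_eq ?_)⟩
  rw [← left_fiberι_apply (toSpecOver X ≫ t₀) t z, toSpecOver_comp_left_apply]

end ConstantMap

/-- **Stub S3 `stub_spreadAlongCurve` of crux `KClassPropagates`, AS REGISTERED, IMPLIES THE SUMMIT.** The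
body of `SpreadAlongCurve` (`Cruxes/KClassPropagates/Lines/birth.lean`, verbatim) implies
`HodgeConjecture` (`Summits/HodgeConjecture/HodgeConjecture/Statement.lean`): apply it to the constant map `X → Spec ℂ → ℙ¹` at a
complex point `t₀` with `U = ℙ¹ ∖ {pt t₀}` — the fibres over `U` are empty (hypothesis vacuous), the fibre
over `t₀` is `X`. [cite: Deligne2000, §1] -/
theorem hodgeConjecture_of_spreadAlongCurve
    (hS : ∀ (N p : ℕ) (𝒳 C : SchemeOver ℂ) (f : 𝒳 ⟶ C),
      IsSmoothProjective N 𝒳 → IsSmoothProjective 1 C →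
      ∀ ξ : complexBetti 𝒳 (2 * p), IsRationalClass ξ → IsOfHodgeType N 𝒳 (2 * p) p p ξ →
      ∀ U : Set C.left, IsOpen U → U.Nonempty →
      (∀ t : AlgPoints C ℂ, t.pt ∈ U → ∀ n : ℕ, IsSmoothProjective n (fiberOver f t) →
        (complexBetti.map (fiberι f t) (2 * p)).hom ξ ∈ algebraicClasses (fiberOver f t) p) →
      ∀ (t : AlgPoints C ℂ) (n : ℕ), IsSmoothProjective n (fiberOver f t) →
        (complexBetti.map (fiberι f t) (2 * p)).hom ξ ∈ algebraicClasses (fiberOver f t) p) :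
    _root_.HodgeConjecture := by
  intro N X hX
  refine ⟨nonempty_hodgeModel_holds hX, fun p c hc hpp => ?_⟩
  -- the curve `ℙ¹`, a point `t₀`, the constant map, and another point `t₁`
  set C : SchemeOver ℂ := projectiveSpace 1 ℂ with hCdef
  have hC : IsSmoothProjective 1 C := isSmoothProjective_projectiveSpace_holds ℂ 1
  haveI := hC.smoothOfRelativeDimension
  haveI : IsProper C.hom := IsSmoothProjective.isProper_holds hC
  haveI : LocallyOfFiniteType C.hom := inferInstance
  have h10 : (![1, 0] : Fin (1 + 1) → ℂ) ≠ 0 := fun h => by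
    have h1 := congrFun h 0
    simp at h1
  let t₀ : ComplexPoints C := ProjectiveSpace.pointOfVec ℂ ![1, 0] h10
  obtain ⟨t₁, ht₁⟩ : ∃ t₁ : ComplexPoints C, t₁ ≠ t₀ := by
    by_contra h
    push Not at h
    apply not_countable_univ_complexPoints_of_smoothCurve (S := C) t₀
    have : (Set.univ : Set (ComplexPoints C)) ⊆ {t₀} := fun t _ => h t
    exact (Set.countable_singleton t₀).mono this
  let f : X ⟶ C := toSpecOver X ≫ t₀
  -- the open `U = ℙ¹ ∖ {pt t₀}`
  have hU : IsOpen ({t₀.pt}ᶜ : Set C.left) := (ComplexPoints.isClosed_pt t₀).isOpen_compl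
  have hUne : ({t₀.pt}ᶜ : Set C.left).Nonempty := ⟨t₁.pt, fun h => ht₁ (Motives.ComplexPoints.ext_of_pt_eq h)⟩
  -- the hypothesis over `U` is vacuous: those fibres are empty
  have hvac : ∀ t : AlgPoints C ℂ, t.pt ∈ ({t₀.pt}ᶜ : Set C.left) → ∀ n : ℕ, IsSmoothProjective n (fiberOver f t) →
      (complexBetti.map (fiberι f t) (2 * p)).hom c ∈ algebraicClasses (fiberOver f t) p := by
    intro t htU n hsm
    exfalso
    have hne : t ≠ t₀ := fun h => htU (by rw [h]; rfl)
    haveI := isEmpty_fiberOver_toSpecOver_comp (X := X) t₀ hne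
    haveI : IrreducibleSpace (fiberOver f t).left := hsm.irreducibleSpace
    exact IsEmpty.false (Classical.arbitrary (fiberOver f t).left)
  -- the fibre over `t₀` is `X`
  haveI := isIso_fiberι_toSpecOver_comp (X := X) t₀
  let e : fiberOver f t₀ ≅ X := Over.isoMk (asIso (fiberι f t₀).left) (Over.w (fiberι f t₀))
  have he : e.hom = fiberι f t₀ := Over.OverMorphism.ext rfl
  have ht₀ : IsSmoothProjective N (fiberOver f t₀) := hX.of_iso e.symm
  have h := hS N p X C f hX hC c hc hpp _ hU hUne hvac t₀ N ht₀
  rw [← he] at h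
  exact (mem_algebraicClasses_map_iff_of_iso e).1 h

/-- **The dominant case of `SpreadAlongCurve` is a theorem** (fibre dimension one less than the total
space): for `f : 𝒳 ⟶ C` with `𝒳` a smooth projective `(n+1)`-fold and `C` a smooth projective curve, ANY class
`ξ ∈ H²ᵖ(𝒳(ℂ); ℂ)` (rationality and Hodge type are not needed), and a non-empty open `U ⊆ C` such that
`ξ|_{𝒳_t}` is algebraic on every smooth projective fibre over `U` (of any dimension): then `ξ|_{𝒳_t}` is
algebraic on every smooth projective `n`-dimensional fibre. Proof = that of `Theorems.stub_specialisation`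
(crux `MovableClassesAlgebraic`) with the good set `(V ∩ U)(ℂ)`, whose fibres are smooth projective `n`-folds.
[cite: CharlesSchnell2014Notes, Prop. 11.3.11 (proof)] [cite: VoisinHodgeII2003, §3.3.1 and §7.3.2] -/
theorem spreadAlongCurve_of_dim_succ {n : ℕ} (p : ℕ) {𝒳 C : SchemeOver ℂ} (f : 𝒳 ⟶ C)
    (h𝒳 : IsSmoothProjective (n + 1) 𝒳) (hC : IsSmoothProjective 1 C) (ξ : complexBetti 𝒳 (2 * p))
    (U : Set C.left) (hU : IsOpen U) (hUne : U.Nonempty)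
    (halg : ∀ t : AlgPoints C ℂ, t.pt ∈ U → ∀ m : ℕ, IsSmoothProjective m (fiberOver f t) →
      (complexBetti.map (fiberι f t) (2 * p)).hom ξ ∈ algebraicClasses (fiberOver f t) p)
    (t : AlgPoints C ℂ) (ht : IsSmoothProjective n (fiberOver f t)) :
    (complexBetti.map (fiberι f t) (2 * p)).hom ξ ∈ algebraicClasses (fiberOver f t) p := by
  -- adapted from `Theorems.stub_specialisation` (crux `MovableClassesAlgebraic`)
  haveI : IsIntegral 𝒳.left := IsSmoothProjective.isIntegral_holds h𝒳
  haveI : IsIntegral C.left := IsSmoothProjective.isIntegral_holds hC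
  haveI := hC.smoothOfRelativeDimension
  haveI := h𝒳.smoothOfRelativeDimension
  haveI : IsProper 𝒳.hom := IsSmoothProjective.isProper_holds h𝒳
  haveI : IsProper C.hom := IsSmoothProjective.isProper_holds hC
  haveI : LocallyOfFiniteType C.hom := inferInstance
  haveI : LocallyOfFiniteType 𝒳.hom := inferInstance
  haveI : IsSeparated C.hom := inferInstance
  haveI : IsSeparated 𝒳.hom := inferInstance
  haveI : IsProper f.left := by
    have h : IsProper (f.left ≫ C.hom) := by rw [Over.w f]; infer_instance
    exact IsProper.of_comp f.left C.hom
  haveI : IsDominant f.left := isDominant_of_isSmoothProjective_fiberOver f h𝒳 hC t ht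
  haveI : Flat f.left := Motives.flat_of_isDominant_of_smoothCurve C f.left
  have h𝒳q : IsQuasiProjectiveOver 𝒳 := IsQuasiProjectiveOver.of_isProjectiveOver h𝒳.isProjectiveOver
  haveI : CompactSpace 𝒳.left := QuasiCompact.compactSpace_of_compactSpace 𝒳.hom
  haveI : CompactSpace C.left := QuasiCompact.compactSpace_of_compactSpace C.hom
  haveI : SecondCountableTopology (ComplexPoints 𝒳) :=
    Motives.ComplexPoints.secondCountableTopology_of_compactSpace_holds 𝒳
  haveI : SecondCountableTopology (ComplexPoints C) :=
    Motives.ComplexPoints.secondCountableTopology_of_compactSpace_holds C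
  haveI : IsLocallyNoetherian C.left := LocallyOfFiniteType.isLocallyNoetherian C.hom
  haveI : IsNoetherian C.left := {}
  -- `f` is smooth of relative dimension `n` over an affine open `V ∋ pt t`
  obtain ⟨V₀, htV₀, hV₀⟩ := exists_smoothOfRelativeDimension_morphismRestrict_of_forall_fibre f.left n t.pt
    (exists_smoothOfRelativeDimension_nhd_of_isSmoothProjective_fiberOver f t ht)
  obtain ⟨V, hVaff, htV, hVle⟩ := exists_isAffineOpen_mem_and_subset (U := V₀) (x := t.pt) htV₀
  haveI hsmV : SmoothOfRelativeDimension n (f.left ∣_ V) := hV₀ V hVle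
  -- the fibres over `V` are smooth projective `n`-folds
  haveI : ConnectedSpace (ComplexPoints (fiberOver f t)) := HodgeTheory.connectedSpace_complexPoints ht
  have hVconn : IsPreconnected {b : ComplexPoints C | b.pt ∈ V} := by
    have h := Motives.ComplexPoints.isConnected_setOf_pt_mem_inter_of_isIrreducible C isClosed_univ
      (IrreducibleSpace.isIrreducible_univ _) V ⟨t.pt, Set.mem_univ _, htV⟩
    have hset : {P : ComplexPoints C | P.pt ∈ (Set.univ : Set C.left) ∧ P.pt ∈ (V : Set C.left)} =
        {b : ComplexPoints C | b.pt ∈ V} := by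
      ext P; simp
    rw [hset] at h
    exact h.isPreconnected
  have hfib : ∀ b : ComplexPoints C, b.pt ∈ V → IsSmoothProjective n (fiberOver f b) := by
    intro b hb
    haveI : SmoothOfRelativeDimension n (fiberOver f b).hom := smoothOfRelativeDimension_fiberOver_hom f V b hb
    exact ⟨inferInstance, isProjectiveOver_fiberOver f h𝒳.isProjectiveOver b,
      SectionFamily.geometricallyIrreducible_fiberOver_of_connectedSpace (d := n) (m := 1) f V hVconn htV b hb⟩
  -- the smooth projective family over `V`
  set g : openSubschemeOver C V ⟶ C := openSubschemeOverι C V with hg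
  have hF : IsSmoothProjectiveFamily (familyPullback.snd f g) n :=
    SectionFamily.isSmoothProjectiveFamily_snd_openSubschemeOverι f V hsmV hfib
  haveI : IsOpenImmersion g.left := inferInstanceAs (IsOpenImmersion V.ι)
  haveI : IsAffine (openSubschemeOver C V).left := hVaff
  haveI : Nonempty (V : Scheme) := ⟨⟨t.pt, htV⟩⟩
  haveI : IsIntegral (openSubschemeOver C V).left := show IsIntegral (V : Scheme) from
    isIntegral_of_isOpenImmersion V.ι
  haveI : SmoothOfRelativeDimension 1 (openSubschemeOver C V).hom := by
    change SmoothOfRelativeDimension 1 (V.ι ≫ C.hom)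
    exact inferInstanceAs (SmoothOfRelativeDimension (0 + 1) (V.ι ≫ C.hom))
  haveI : LocallyOfFiniteType (openSubschemeOver C V).hom := by
    change LocallyOfFiniteType (V.ι ≫ C.hom); infer_instance
  have hBq : IsQuasiProjectiveOver (openSubschemeOver C V) := IsQuasiProjectiveOver.of_isAffine _
  have h𝒳Vq : IsQuasiProjectiveOver (familyPullback f g) := isQuasiProjectiveOver_familyPullback f g inferInstance h𝒳q
  have hrange : Set.range (AlgPoints.map (L := ℂ) g) = {P | P.pt ∈ V} := by
    rw [AlgPoints.range_map_of_isOpenImmersion_holds]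
    ext P
    change P.pt ∈ V.ι.opensRange ↔ P.pt ∈ V
    rw [Scheme.Opens.opensRange_ι]
  -- the global class on the family over `V` and its fibre restrictions
  set ξV : complexBetti (familyPullback f g) (2 * p) := complexBetti.map (familyPullback.fst f g) (2 * p) ξ
    with hξV
  have key : ∀ u : ComplexPoints (openSubschemeOver C V),
      complexBetti.map (fiberι (familyPullback.snd f g) u) (2 * p) ξV ∈
          algebraicClasses (fiberOver (familyPullback.snd f g) u) p ↔
        complexBetti.map (fiberι f (AlgPoints.map g u)) (2 * p) ξ ∈
          algebraicClasses (fiberOver f (AlgPoints.map g u)) p := by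
    intro u
    rw [hξV, map_fiberι_familyPullback]
    exact mem_algebraicClasses_map_iff_of_iso (fiberOverFamilyPullbackIso f g u)
  have hmemV : ∀ u : ComplexPoints (openSubschemeOver C V), (AlgPoints.map g u).pt ∈ V := fun u => by
    have h : AlgPoints.map g u ∈ Set.range (AlgPoints.map (L := ℂ) g) := ⟨u, rfl⟩
    rw [hrange] at h
    exact h
  -- the good set: points over `V ∩ U`, uncountable (its complement lies over the finite `C ∖ U`)
  obtain ⟨u₀, rfl⟩ : t ∈ Set.range (AlgPoints.map (L := ℂ) g) := by rw [hrange]; exact htV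
  have hG : ¬ {u : ComplexPoints (openSubschemeOver C V) | (AlgPoints.map g u).pt ∈ U}.Countable := by
    intro hc
    have hUc : IsClosed Uᶜ := hU.isClosed_compl
    have hUcu : Uᶜ ≠ Set.univ := fun h => by
      obtain ⟨x, hx⟩ := hUne
      have : x ∈ Uᶜ := h ▸ Set.mem_univ x
      exact this hx
    have hfin : {u : ComplexPoints (openSubschemeOver C V) | (AlgPoints.map g u).pt ∈ Uᶜ}.Finite :=
      Set.Finite.preimage (f := AlgPoints.map (L := ℂ) g) (s := {t' : ComplexPoints C | t'.pt ∈ Uᶜ})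
        (AlgPoints.map_injective_of_mono (L := ℂ) g).injOn
        (finite_setOf_pt_mem_of_isClosed_of_ne_univ (S := C) hUc hUcu)
    apply not_countable_univ_complexPoints_of_smoothCurve (S := openSubschemeOver C V) u₀
    refine (hc.union hfin.countable).mono fun u _ => ?_
    by_cases h : (AlgPoints.map g u).pt ∈ U
    · exact Or.inl h
    · exact Or.inr h
  have hGalg : ∀ u ∈ {u : ComplexPoints (openSubschemeOver C V) | (AlgPoints.map g u).pt ∈ U},
      complexBetti.map (fiberι (familyPullback.snd f g) u) (2 * p) ξV ∈
        algebraicClasses (fiberOver (familyPullback.snd f g) u) p :=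
    fun u hu => (key u).2 (halg _ hu n (hfib _ (hmemV u)))
  -- the curve-base dichotomy
  have h := mem_algebraicClasses_of_not_countable_of_smoothCurve (familyPullback.snd f g) h𝒳Vq hBq hF p ξV
    hG hGalg u₀
  exact (key u₀).1 h

end Summit.HodgeConjecture.HodgeConjecture.Theorems

end
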